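import Summits.ValiantsHypothesis.ValiantsHypothesis.Theorems.MonotoneRestorationOrbitRestorationQPSignFree
import HarnessLib

/-!
# The square of every symmetric affine product is orbit-restorable (ORBIT currency, XIX)

Route MonotoneRestoration, crux `OrbitRestorationQP` (stmt-ValiantsHypothesis-18293), namespace
`Summit.ValiantsHypothesis.ValiantsHypothesis.Theorems.SignFree`.

The `k = 1` sub-rung (ΠΣ) of the first rung of line `depth-three-rung` holds UP TO SQUARING, unconditionally:
if `f = a · Π L ≠ 0` is a product of fewer than `C(n,k)` degree-one forms on the `n × n` matrix (`n > 8`,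
`4k ≤ n`), invariant under the diagonal action of `Sym(Fin n)`, then `f²` is `QPOrbitRestorable (k + 5)`
(`qpOrbitRestorable_sq`).  Reason: a transposition inside a support `T` maps the support block `G_T` to
`± G_T` (it is an involution and acts by a unit, `SupportBlocks.exists_unit_block`), so it FIXES `G_T²`: the
doubled factor list has untwisted support blocks and `SupportBlocks.qpOrbitRestorable_of_untwisted_supportBlocks`
applies with the canonical support of `SignFree.exists_supportAssignment`.  So the whole obstruction to the ΠΣ
rung is a SIGN (a symmetric square root), cf. the census of the seat.  Everything is proved. [folklore]
-/

noncomputable section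

open scoped Classical Pointwise

-- `Summit.ValiantsHypothesis.ValiantsHypothesis.…` is the tree's single-conjunct layout (Sub = Summit).
set_option linter.dupNamespace false

namespace Summit.ValiantsHypothesis.ValiantsHypothesis.Theorems

namespace SignFree

open Equiv Finset Literature.Computability.AlgebraicComplexity OrbitRestorationQPDepthThreeRung

variable {n : ℕ}

/-- An involution acting on a nonzero polynomial by a scalar acts by `±1`, hence fixes its square. [folklore] -/
theorem ren_sq_eq_of_involution {τ : Perm (Fin n)} (hτ : τ * τ = 1) {G : MvPolynomial (Fin n × Fin n) ℂ}
    (hG : G ≠ 0) {c : ℂ} (hc : ren τ G = MvPolynomial.C c * G) : ren τ (G * G) = G * G := by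
  have h2 : MvPolynomial.C (c * c) * G = MvPolynomial.C 1 * G := by
    have h := congrArg (ren τ) hc
    rw [← ren_mul, hτ, ren_one, map_mul, ren_C, hc, ← mul_assoc, ← map_mul] at h
    rw [map_one, one_mul]; exact h.symm
  have hcc : c * c = 1 := MvPolynomial.C_injective _ _ (mul_right_cancel₀ hG h2)
  rw [map_mul, hc]
  calc MvPolynomial.C c * G * (MvPolynomial.C c * G) = MvPolynomial.C (c * c) * (G * G) := by rw [map_mul]; ring
    _ = G * G := by rw [hcc, map_one, one_mul]

/-- **THE SQUARE OF A SYMMETRIC AFFINE PRODUCT IS ORBIT-RESTORABLE.**  Let `n > 8`, `1 ≤ k`, `4k ≤ n`, and let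
`f = a · Π L ≠ 0` be a product of fewer than `C(n,k)` forms of total degree `1`, invariant under the diagonal
action of `Sym(Fin n)`.  Then `f · f` is `QPOrbitRestorable (k + 5)` at level `n`.
[folklore; cite: DawarWilsenach2025, §3.3 and §6; DixonMortimer1996, Thm 5.2B] -/
theorem qpOrbitRestorable_sq {k : ℕ} (hn : 8 < n) (hk : 1 ≤ k) (h4k : 4 * k ≤ n)
    (L : Multiset (MvPolynomial (Fin n × Fin n) ℂ)) (a : ℂ)
    (hL1 : ∀ ℓ ∈ L, ℓ.totalDegree = 1) (hcard : Multiset.card L < n.choose k)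
    (hf0 : MvPolynomial.C a * L.prod ≠ 0)
    (hfix : ∀ σ : Perm (Fin n), ren σ (MvPolynomial.C a * L.prod) = MvPolynomial.C a * L.prod) :
    QPOrbitRestorable (k + 5) n ((MvPolynomial.C a * L.prod) * (MvPolynomial.C a * L.prod)) := by
  obtain ⟨supp, S1, S2, S3⟩ := exists_supportAssignment n
  have hfac : ∀ ℓ ∈ L, (supp ℓ).card ≤ k ∧ ∀ τ : Perm (Fin n), (∀ x ∈ supp ℓ, τ x = x) → ren τ ℓ = ℓ := by
    intro ℓ hℓ
    obtain ⟨X, hXk, hX⟩ := AffineFactors.exists_support_of_mem_factors hn hk h4k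
      (fun ℓ hℓ => (hL1 ℓ hℓ).le) hcard hf0 hfix hℓ
    obtain ⟨h1, h2⟩ := S3 ℓ X (by omega) hX
    exact ⟨h1.trans (by omega), h2⟩
  -- the doubled factor list
  have hsq : (MvPolynomial.C a * L.prod) * (MvPolynomial.C a * L.prod) = MvPolynomial.C (a * a) * (L + L).prod := by
    rw [Multiset.prod_add, map_mul]; ring
  have hf0' : MvPolynomial.C (a * a) * (L + L).prod ≠ 0 := by rw [← hsq]; exact mul_ne_zero hf0 hf0
  have hfix' : ∀ σ : Perm (Fin n), ren σ (MvPolynomial.C (a * a) * (L + L).prod) =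
      MvPolynomial.C (a * a) * (L + L).prod := fun σ => by rw [← hsq, map_mul, hfix σ]
  have hmem : ∀ ℓ ∈ L + L, ℓ ∈ L := fun ℓ hℓ => by simpa using Multiset.mem_add.1 hℓ
  rw [hsq]
  refine SupportBlocks.qpOrbitRestorable_of_untwisted_supportBlocks (L + L) (a * a) supp S1 S2
    (fun ℓ hℓ => (hfac ℓ (hmem ℓ hℓ)).2) (fun ℓ hℓ => (hfac ℓ (hmem ℓ hℓ)).1) (fun ℓ hℓ => hL1 ℓ (hmem ℓ hℓ))
    hf0' hfix' fun T x hx y hy => ?_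
  -- the doubled block is the square of the block, fixed by the involution `(x y)`
  have hblk : ((L + L).filter fun ℓ => supp ℓ = T).prod =
      (L.filter fun ℓ => supp ℓ = T).prod * (L.filter fun ℓ => supp ℓ = T).prod := by
    rw [Multiset.filter_add, Multiset.prod_add]
  obtain ⟨c, -, hc⟩ := SupportBlocks.exists_unit_block supp S1 S2 hL1 hf0 hfix (swap x y) T
  rw [swap_smul_finset_eq hx hy] at hc
  have hG0 : (L.filter fun ℓ => supp ℓ = T).prod ≠ 0 :=
    Multiset.prod_ne_zero fun h => AffineFactors.ne_zero_of_mem hf0 (Multiset.mem_filter.1 h).1 rfl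
  rw [hblk]
  exact ren_sq_eq_of_involution (swap_mul_self x y) hG0 hc

end SignFree

end Summit.ValiantsHypothesis.ValiantsHypothesis.Theorems

end
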